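import Summits.Parity.GeneralizedHardyLittlewood.Theorems.LeeYangFibresAbsoluteUpgradeCellsToDimOne
import Summits.Parity.GeneralizedHardyLittlewood.Theorems.LeeYangFibresRelativeDimOne
import HarnessLib

/-!
# Route `LeeYangFibres`, crux `AbsoluteUpgrade` (stmt-Parity-14116): the shared cell-level node of
# the two mechanism lines is the target `DimOne` itself

Both complete mechanism lines of the crux — `nlc-cells-absolute-clip` (reduction
`dimOne_of_nlcInputs`, `Theorems/LeeYangFibresAbsoluteUpgradeNlcReduction`) and
`dip-margin-rate-exchange` (`dimOne_of_dipInputs`, `Theorems/LeeYangFibresAbsoluteUpgradeDipReduction`) —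
factor through ONE cell-level node, `NlcCellsAbsoluteClip.PrimeCellsAbsolute` (the prime corner cell
`#{n ∈ K ∩ [-N,N] ∩ ℤ : every ψ_i(n) a prime > N^{1/u}}` equals its model
`β_∞ ∏_p β_p (A₁(N)/N)^t`, `A₁(N) = π(N) - π(N^{1/u})`, up to an ABSOLUTE error `ε N / log^t N` at some
roughness `u(N) ≥ 2`), and the registered stub `stub_cellsToDimOne : PrimeCellsAbsolute → DimOne` is
landed (`Theorems/LeeYangFibresAbsoluteUpgradeCellsToDimOne`, p100021).

This file proves the CONVERSE, `primeCellsAbsolute_of_dimOne : DimOne → PrimeCellsAbsolute`, hence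
`primeCellsAbsolute_iff_dimOne : PrimeCellsAbsolute ↔ DimOne` and the normal form
`absoluteUpgrade_iff_cells : AbsoluteUpgrade ↔ (RelativeDimOne → PrimeCellsAbsolute)`.
So the node the planners were advised to promote (lead dossiers c1/c2) is the shared target
`DimOne` (stmt-Parity-0819) in cell clothing: promoting it re-files the target, and the two lines are
reformulations of `DimOne` as (cell law with a rate) + (zero-locus / negative-lattice structure),
in neither of which the crux's hypothesis `RelativeDimOne` is used.

The converse is Green–Tao's deduction "(1.2) ⟹ (1.8)" with the first (relative) error term of (1.8)
ELIMINATED, which they note is possible for bounded systems but do not carry out: the singular mass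
`M = β_∞ ∏_p β_p` may be as large as `G N`, `G = (2 C(t,L) + 1)(log log N)^{t-1}`
(`stub_singularProduct_le_loglog_pow`, `archFactor_le_two_mul`), so every multiplicative distortion
must be `o(1/G)`; running the sandwich `vonMangoldtSum_primePointCount_sandwich` at threshold
`Y = N / log^{t+1} N` (`log`-window `η = ((t+1) log log N + log 2L)/log N`) and using the prime number
theorem WITH RATE for `(A₁ log N / N)^t` (`mainTerm_window`) makes them `O(G log log N / log N) → 0`.
All inputs are the landed helpers of `stub_cellsToDimOne` (`…CellsToDimOneAux`: `pow_near_one`,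
`eventually_loglog`, `exists_primeCounting_rate`, `errorCounts_le`, `mainTerm_window`), used in the
opposite direction; the new arithmetic heart is `cells_arith_abs_converse`.

References: B. Green, T. Tao, *Linear equations in primes*, Ann. of Math. 171 (2010), Conj. 1.2,
(1.8) and the sketch proof of Conj. 1.4 ("In particular we can eliminate the first error term in (1.8)
in this setting") [GreenTao2010]; H. L. Montgomery, R. C. Vaughan, *Multiplicative Number Theory I*
(2007), Theorem 6.9 [MontgomeryVaughan2007].
-/

noncomputable section

namespace Summit.Parity.GeneralizedHardyLittlewood.Theorems.AbsoluteUpgrade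

open Filter Finset Asymptotics
open scoped Topology
open Literature.NumberTheory.Sieve Literature.NumberTheory.LFunctions
open Summit.Parity.GeneralizedHardyLittlewood.Theses.LeeYangFibres
open Summit.Parity.GeneralizedHardyLittlewood.Cruxes.AbsoluteUpgrade.NlcCellsAbsoluteClip
open Summit.Parity.GeneralizedHardyLittlewood.Theorems.LeeYangFibresCells
open Summit.Parity.GeneralizedHardyLittlewood.Cruxes.CellParityLaw.SectionAnnihilator.SingularRatio
  (singularProduct_nonneg)
open Summit.Parity.GeneralizedHardyLittlewood.Theorems.LeeYangFibresRelativeDimOne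
  (vonMangoldtSum_nonneg relativeDimOne_of_dimOne)

/-! ### The arithmetic heart, converse direction -/

/-- **Arithmetic heart, converse (absolute) form.** From the sandwich `(1-δ) Tg ≤ S ≤ (1+δ)(Tg + Tb + Tc)`
(`0 ≤ δ ≤ 1/4`, `M, Tg, Tb, Tc ≥ 0`), the comparison `TC ≤ Tg + Tb`, `Tg ≤ TC + Tb₂` of the cells with the
good points, the von Mangoldt asymptotic `|S - M| ≤ E₁`, the main-term comparison `|MK - M| ≤ E₂`, the
smallness `Tb + Tc + Tb₂ ≤ E₃` of the error counts and `δ M ≤ E₄`: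
`|TC - MK| ≤ 2 E₁ + E₂ + 2 E₃ + 2 E₄`. [folklore] -/
theorem cells_arith_abs_converse {S M Tg Tb Tc Tb2 TC MK δ E₁ E₂ E₃ E₄ : ℝ} (hδ0 : 0 ≤ δ)
    (hδ4 : δ ≤ 1 / 4) (hM : 0 ≤ M) (hTg : 0 ≤ Tg) (hTb : 0 ≤ Tb) (hTc : 0 ≤ Tc) (hTb2 : 0 ≤ Tb2)
    (hS1 : (1 - δ) * Tg ≤ S) (hS2 : S ≤ (1 + δ) * (Tg + Tb + Tc)) (hG1 : TC ≤ Tg + Tb)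
    (hG2 : Tg ≤ TC + Tb2) (hSM : |S - M| ≤ E₁) (hK : |MK - M| ≤ E₂) (hE : Tb + Tc + Tb2 ≤ E₃)
    (hδM : δ * M ≤ E₄) : |TC - MK| ≤ 2 * E₁ + E₂ + 2 * E₃ + 2 * E₄ := by
  obtain ⟨hSM1, hSM2⟩ := abs_le.mp hSM
  obtain ⟨hK1, hK2⟩ := abs_le.mp hK
  have hE₁ : 0 ≤ E₁ := (abs_nonneg _).trans hSM
  have hE₄ : 0 ≤ E₄ := (mul_nonneg hδ0 hM).trans hδM
  have h1 : (1 - δ) * Tg = Tg - δ * Tg := by ring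
  have h2 : (1 + δ) * (Tg + Tb + Tc) = (Tg + Tb + Tc) + δ * Tg + δ * (Tb + Tc) := by ring
  -- `Tg ≤ (4/3)(M + E₁)` from `(3/4) Tg ≤ (1-δ) Tg ≤ S ≤ M + E₁`
  have h34 : 3 / 4 * Tg ≤ (1 - δ) * Tg := mul_le_mul_of_nonneg_right (by linarith) hTg
  have hTg43 : Tg ≤ 4 / 3 * (M + E₁) := by linarith
  -- `δ Tg ≤ (4/3) E₄ + (1/3) E₁`
  have hδTg : δ * Tg ≤ 4 / 3 * E₄ + 1 / 3 * E₁ := by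
    have h3 : δ * Tg ≤ δ * (4 / 3 * (M + E₁)) := mul_le_mul_of_nonneg_left hTg43 hδ0
    have h4 : δ * E₁ ≤ 1 / 4 * E₁ := mul_le_mul_of_nonneg_right hδ4 hE₁
    have h5 : δ * (4 / 3 * (M + E₁)) = 4 / 3 * (δ * M) + 4 / 3 * (δ * E₁) := by ring
    linarith
  -- `δ (Tb + Tc) ≤ Tb + Tc`
  have hδbc : δ * (Tb + Tc) ≤ 1 * (Tb + Tc) :=
    mul_le_mul_of_nonneg_right (by linarith) (by linarith)
  rw [abs_le]
  constructor
  · -- lower bound: `TC ≥ Tg - Tb2`, `Tg + Tb + Tc ≥ M - E₁ - δ Tg - δ (Tb + Tc)`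
    have hlow : M - E₁ ≤ (Tg + Tb + Tc) + δ * Tg + δ * (Tb + Tc) := by linarith
    linarith
  · -- upper bound: `TC ≤ Tg + Tb`, `Tg ≤ M + E₁ + δ Tg`
    have hup : Tg - δ * Tg ≤ M + E₁ := by linarith
    linarith

/-! ### One scale -/

/-- **Main step at one scale `N` (converse, absolute form).** Under the growth conditions on
`ℓ = log N` listed as hypotheses (all eventually true for fixed `t, L, ε, c₂, C_π` and
`G = G₀ (log log N)^{t-1}`), the comparison `Cn ≤ P ≤ Cn + t(2N^{1/u}+1)` of the cell count `Cn` with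
the prime-point count, the window `π(N) - N^{1/u} ≤ A₁ ≤ π(N)`, the prime number theorem with rate
`|π(N) ℓ - N| ≤ C_π N/ℓ`, the mass bound `0 ≤ M ≤ G N` and the ABSOLUTE von Mangoldt asymptotic
`|∑ ∏ Λ(ψᵢ(n)) - M| ≤ (ε/16) N`, one has the absolute cell asymptotic `|Cn - M (A₁/N)^t| ≤ ε N / ℓ^t`.
[cite: GreenTao2010, Conj. 1.4 (sketch proof) and (1.8)] -/
theorem abs_cells_sub_le_of_vonMangoldtSum {t L N u : ℕ} {ε c₂ G Cπ Cn A₁ M : ℝ}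
    (Ψ : Fin t → AffLinForm 1) (K : Set (Fin 1 → ℝ)) (ht : 1 ≤ t) (hN3 : 3 ≤ N) (hu2 : 2 ≤ u)
    (hε : 0 < ε) (hε1 : ε ≤ 1) (hΨ : IsNondegenerateSystem Ψ) (hL : affLinSize Ψ N ≤ L)
    (hc₂0 : 0 < c₂) (hc₂ : 12 * t * (Real.sqrt (2 * L) + 1) * c₂ ≤ ε / 16)
    (hℓt : 144 * t ≤ ε * Real.log N) (hℓpow : Real.log N ^ (t + 1) ≤ 1 * N)
    (hℓsqrt : Real.log N ^ (t + 1) ≤ c₂ * Real.sqrt N)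
    (hG1 : 1 ≤ G) (hM0 : 0 ≤ M) (hMG : M ≤ G * N)
    (hdist : 8 * t * ((t + 1) * Real.log (Real.log N) + Real.log (2 * L)) * G ≤ ε * Real.log N)
    (hCπ : 0 ≤ Cπ) (hπ : |(Nat.primeCounting N : ℝ) * Real.log N - N| ≤ Cπ * N / Real.log N)
    (hkap : 16 * t * (Cπ + 1) * G ≤ ε * Real.log N)
    (hVM : |vonMangoldtSum Ψ K N - M| ≤ ε / 16 * N)
    (hC1 : Cn ≤ primePointCount Ψ K N)
    (hC2 : (primePointCount Ψ K N : ℝ) ≤ Cn + t * (2 * (N : ℝ) ^ ((1 : ℝ) / u) + 1))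
    (hA1 : (Nat.primeCounting N : ℝ) ≤ A₁ + (N : ℝ) ^ ((1 : ℝ) / u))
    (hA2 : A₁ ≤ Nat.primeCounting N) :
    |Cn - M * (A₁ / N) ^ t| ≤ ε * N / Real.log N ^ t := by
  -- adapted from `abs_vonMangoldtSum_sub_le_abs_of_cells` (same bookkeeping, opposite direction)
  have hN1 : 1 ≤ N := by omega
  have hx3 : (3 : ℝ) ≤ N := by exact_mod_cast hN3
  have hx0 : (0 : ℝ) < N := by linarith
  have ht1 : (1 : ℝ) ≤ t := by exact_mod_cast ht
  have hℓ1 : 1 < Real.log N := by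
    rw [Real.lt_log_iff_exp_lt hx0]
    linarith [Real.exp_one_lt_d9]
  set ℓ : ℝ := Real.log N with hℓdef
  have hℓ0 : 0 < ℓ := by linarith
  set T : ℝ := ℓ ^ t with hTdef
  have hT : 0 < T := pow_pos hℓ0 t
  have hℓt1 : 0 < ℓ ^ (t + 1) := pow_pos hℓ0 _
  obtain ⟨i₀⟩ : Nonempty (Fin t) := ⟨⟨0, ht⟩⟩
  have hL1 : (1 : ℝ) ≤ L := one_le_of_affLinSize_le Ψ hΨ hL i₀
  have hlog2L : 0 ≤ Real.log (2 * L) := Real.log_nonneg (by linarith)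
  have hlogℓ : 0 ≤ Real.log ℓ := Real.log_nonneg hℓ1.le
  have hεN : 0 ≤ ε * N := by positivity
  -- the distortion `η = ((t+1) log ℓ + log 2L) / ℓ` and `δ = 2 t η ≤ ε / (4 G)`
  set η : ℝ := ((t + 1) * Real.log ℓ + Real.log (2 * L)) / ℓ with hηdef
  have hηℓ : η * ℓ = (t + 1) * Real.log ℓ + Real.log (2 * L) := div_mul_cancel₀ _ hℓ0.ne'
  have hη0 : 0 ≤ η := div_nonneg (by positivity) hℓ0.le
  have hηG : 8 * t * η * G ≤ ε := by
    have h1 : 8 * t * η * G * ℓ ≤ ε * ℓ := by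
      calc 8 * t * η * G * ℓ = 8 * t * (η * ℓ) * G := by ring
        _ = 8 * t * ((t + 1) * Real.log ℓ + Real.log (2 * L)) * G := by rw [hηℓ]
        _ ≤ ε * ℓ := hdist
    exact le_of_mul_le_mul_right h1 hℓ0
  have htη : t * η ≤ 1 / 8 := by
    have h1 : t * η * 1 ≤ t * η * G := mul_le_mul_of_nonneg_left hG1 (by positivity)
    linarith only [h1, hηG, hε1]
  have hη1 : η ≤ 1 / 8 := by
    have : 1 * η ≤ t * η := mul_le_mul_of_nonneg_right ht1 hη0
    linarith only [this, htη]
  set δ : ℝ := 2 * t * η with hδdef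
  have hδ0 : 0 ≤ δ := by positivity
  have hδ4 : δ ≤ 1 / 4 := by linarith only [hδdef, htη]
  have hδG : δ * G ≤ ε / 4 := by
    have : δ * G = (8 * t * η * G) / 4 := by rw [hδdef]; ring
    linarith only [this, hηG]
  obtain ⟨hpow_hi, hpow_lo⟩ :=
    pow_near_one t hη0 (by linarith only [hη1]) (by linarith only [htη])
  -- the threshold `Y = N / ℓ^{t+1}` and the sandwich
  set Y : ℝ := N / ℓ ^ (t + 1) with hYdef
  have hY1 : 1 ≤ Y := by
    rw [hYdef, le_div_iff₀ hℓt1, one_mul]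
    linarith only [hℓpow]
  have hlogY : (1 - η) * ℓ ≤ Real.log Y := by
    rw [hYdef, Real.log_div hx0.ne' hℓt1.ne', Real.log_pow, ← hℓdef]
    push_cast
    linarith only [hηℓ, hlog2L]
  have ha0' : 0 ≤ (1 - η) * ℓ := mul_nonneg (by linarith only [hη1]) hℓ0.le
  have hb : Real.log (2 * L * N) ≤ (1 + η) * ℓ := by
    rw [Real.log_mul (by positivity) hx0.ne', ← hℓdef]
    have : 0 ≤ (t + 1 : ℝ) * Real.log ℓ := by positivity
    linarith only [this, hηℓ]
  have hb2 : Real.log (2 * L * N) ≤ 2 * ℓ := by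
    have : η * ℓ ≤ 1 * ℓ := mul_le_mul_of_nonneg_right (by linarith only [hη1]) hℓ0.le
    linarith only [hb, this]
  obtain ⟨g, β, γ, hg, hβ, hγ, hS1, hS2, hP1, hP2, hβle, hγle⟩ :=
    vonMangoldtSum_primePointCount_sandwich hN1 Ψ hΨ hL K ht hY1 ha0' hlogY hb
  simp only [Nat.sub_self, pow_zero, mul_one] at hβle hγle
  -- `c₂ ≤ 1`, hence `ℓ² ≤ √N` and `ℓ √N ≤ N / ℓ`
  have hs0 : 0 < Real.sqrt (N : ℝ) := Real.sqrt_pos.mpr hx0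
  have hsL0 : 0 ≤ Real.sqrt (2 * (L : ℝ)) := Real.sqrt_nonneg _
  have hc₂1 : c₂ ≤ 1 := by
    have h1 : 12 * c₂ ≤ 12 * t * (Real.sqrt (2 * L) + 1) * c₂ := by
      refine mul_le_mul_of_nonneg_right ?_ hc₂0.le
      have h2 : (12 : ℝ) * 1 ≤ 12 * t := by linarith only [ht1]
      have h3 : 12 * (t : ℝ) * 1 ≤ 12 * t * (Real.sqrt (2 * L) + 1) :=
        mul_le_mul_of_nonneg_left (by linarith only [hsL0]) (by positivity)
      linarith only [h2, h3]
    linarith only [h1, hc₂, hε1]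
  have hsℓ : Real.sqrt N * ℓ ≤ N / ℓ := by
    have hℓ2s : ℓ * ℓ ≤ Real.sqrt N := by
      calc ℓ * ℓ = ℓ ^ 2 := (sq ℓ).symm
        _ ≤ ℓ ^ (t + 1) := pow_le_pow_right₀ hℓ1.le (by omega)
        _ ≤ c₂ * Real.sqrt N := hℓsqrt
        _ ≤ 1 * Real.sqrt N := mul_le_mul_of_nonneg_right hc₂1 hs0.le
        _ = Real.sqrt N := one_mul _
    rw [le_div_iff₀ hℓ0]
    calc Real.sqrt N * ℓ * ℓ = Real.sqrt N * (ℓ * ℓ) := by ring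
      _ ≤ Real.sqrt N * Real.sqrt N := mul_le_mul_of_nonneg_left hℓ2s hs0.le
      _ = N := Real.mul_self_sqrt hx0.le
  -- `E₂`: the main-term window `|M κ - M| ≤ ε N / 8`, `κ = (A₁ ℓ / N)^t`
  set κ : ℝ := (A₁ / N) ^ t * T with hκdef
  have hE2 : |M * κ - M| ≤ ε / 8 * N :=
    mainTerm_window ht hN3 hu2 hε hε1 hG1 hM0 hMG hCπ hπ hkap hsℓ hA1 hA2
  -- `E₃`: the three error counts
  have hE3 : T * β + T * γ + T * (t * (2 * (N : ℝ) ^ ((1 : ℝ) / u) + 1)) ≤ ε / 16 * N :=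
    errorCounts_le ht hN3 hu2 hε hc₂0 hc₂ hℓt hℓpow hℓsqrt hb2 hβle hγle
  -- the sandwich rescaled to `(1 ± δ) T`
  have hlo : (1 - δ) * T ≤ ((1 - η) * ℓ) ^ t := by
    rw [mul_pow]
    refine mul_le_mul_of_nonneg_right ?_ hT.le
    have : 0 ≤ (t : ℝ) * η := by positivity
    linarith only [this, hpow_lo, hδdef]
  have hhi : ((1 + η) * ℓ) ^ t ≤ (1 + δ) * T := by
    rw [mul_pow]
    exact mul_le_mul_of_nonneg_right (by linarith only [hpow_hi, hδdef]) hT.le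
  have hS1' : (1 - δ) * (T * g) ≤ vonMangoldtSum Ψ K N := by
    calc (1 - δ) * (T * g) = (1 - δ) * T * g := by ring
      _ ≤ ((1 - η) * ℓ) ^ t * g := mul_le_mul_of_nonneg_right hlo hg
      _ ≤ _ := hS1
  have hS2' : vonMangoldtSum Ψ K N ≤ (1 + δ) * (T * g + T * β + T * γ) := by
    calc vonMangoldtSum Ψ K N ≤ ((1 + η) * ℓ) ^ t * (g + β + γ) := hS2
      _ ≤ (1 + δ) * T * (g + β + γ) :=
          mul_le_mul_of_nonneg_right hhi (by linarith only [hg, hβ, hγ])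
      _ = (1 + δ) * (T * g + T * β + T * γ) := by ring
  -- the cells against the good points, rescaled by `T`
  have hG1' : T * Cn ≤ T * g + T * β := by
    have h1 : Cn ≤ g + β := hC1.trans hP2
    have h2 := mul_le_mul_of_nonneg_left h1 hT.le
    linarith only [h2]
  have hG2' : T * g ≤ T * Cn + T * (t * (2 * (N : ℝ) ^ ((1 : ℝ) / u) + 1)) := by
    have h1 : g ≤ Cn + t * (2 * (N : ℝ) ^ ((1 : ℝ) / u) + 1) := by linarith only [hP1, hC2]
    have h2 := mul_le_mul_of_nonneg_left h1 hT.le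
    linarith only [h2]
  -- `E₄ = δ M ≤ ε N / 4` and the arithmetic heart
  have hδM : δ * M ≤ ε / 4 * N := by
    calc δ * M ≤ δ * (G * N) := mul_le_mul_of_nonneg_left hMG hδ0
      _ = δ * G * N := by ring
      _ ≤ ε / 4 * N := mul_le_mul_of_nonneg_right hδG hx0.le
  have key := cells_arith_abs_converse hδ0 hδ4 hM0 (mul_nonneg hT.le hg) (mul_nonneg hT.le hβ)
    (mul_nonneg hT.le hγ) (by positivity) hS1' hS2' hG1' hG2' hVM hE2 hE3 hδM
  have hTC : |T * Cn - M * κ| ≤ ε * N := by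
    refine key.trans ?_
    linarith only [hεN]
  -- divide by `T = ℓ^t`
  rw [le_div_iff₀ hT]
  have h2 : |Cn - M * (A₁ / N) ^ t| * T = |T * Cn - M * κ| := by
    rw [← abs_of_pos hT, ← abs_mul, abs_of_pos hT]
    congr 1
    rw [hκdef]
    ring
  rw [hTdef] at h2 hTC
  rw [h2]
  exact hTC

/-! ### `DimOne → PrimeCellsAbsolute`, uniformly in the roughness -/

/-- **Absolute prime cells from `DimOne`, at every roughness `u ≥ 2` simultaneously.** Given
`DimOne`, for all `t ≥ 1`, `L`, `ε > 0` and large `N`, uniformly over `u ≥ 2`, nondegenerate `Ψ` of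
size `≤ L` and convex `K ⊆ [-N, N]`: the prime corner cell is its model
`β_∞ ∏_p β_p (A₁(N)/N)^t` up to `ε N / log^t N` (Green–Tao's (1.8) with the relative error term
eliminated, the mass being `≤ (2 C(t,L) + 1)(log log N)^{t-1} N` by `stub_singularProduct_le_loglog_pow`).
[cite: GreenTao2010, (1.8) and Conj. 1.4 (sketch proof)] -/
theorem cells_abs_of_dimOne (hD : DimOne) (t L : ℕ) (ht : 1 ≤ t) (ε : ℝ) (hε : 0 < ε) :
    ∃ N₀ : ℕ, ∀ N : ℕ, N₀ ≤ N → ∀ u : ℕ, 2 ≤ u →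
      ∀ Ψ : Fin t → AffLinForm 1, IsNondegenerateSystem Ψ → affLinSize Ψ N ≤ L →
        ∀ K : Set (Fin 1 → ℝ), Convex ℝ K → K ⊆ realBox 1 N →
          |(jointCell Ψ K N u (fun _ => 1) : ℝ) - modelCell Ψ K N u (fun _ => 1)| ≤
            ε * N / Real.log N ^ t := by
  -- adapted from `stub_cellsToDimOne` (same thresholds; `DimOne` at precision `ε₀ / 16`)
  set ε₀ : ℝ := min ε 1 with hε₀def
  have hε₀ : 0 < ε₀ := lt_min hε one_pos
  have hε₀1 : ε₀ ≤ 1 := min_le_right _ _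
  have hε₀ε : ε₀ ≤ ε := min_le_left _ _
  have ht0 : (0 : ℝ) < t := by exact_mod_cast ht
  -- the singular-product bound (S1), the prime number theorem with rate, `DimOne` at `ε₀ / 16`
  obtain ⟨CS, hCS, N₁, hN₁⟩ := stub_singularProduct_le_loglog_pow t L ht
  obtain ⟨Cπ, hCπ, hπev⟩ := exists_primeCounting_rate
  obtain ⟨N₂, hN₂⟩ := Filter.eventually_atTop.mp hπev
  obtain ⟨N₃, hN₃⟩ := hD t L ht (ε₀ / 16) (by positivity)
  -- growth conditions on the scale
  have hden : (0 : ℝ) < 12 * t * (Real.sqrt (2 * L) + 1) := by positivity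
  set c₂ : ℝ := ε₀ / 16 / (12 * t * (Real.sqrt (2 * L) + 1)) with hc₂def
  have hc₂0 : 0 < c₂ := div_pos (by positivity) hden
  have hc₂ : 12 * t * (Real.sqrt (2 * L) + 1) * c₂ ≤ ε₀ / 16 := by
    rw [hc₂def, mul_div_cancel₀ _ hden.ne']
  obtain ⟨N₄, hN₄⟩ := Filter.eventually_atTop.mp
    (eventually_log_growth t (144 * t / ε₀) one_pos one_pos hc₂0)
  set G₀ : ℝ := 2 * CS + 1 with hG₀def
  obtain ⟨N₅, hN₅⟩ := Filter.eventually_atTop.mp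
    (eventually_loglog (t - 1) (8 * t * (t + 1) * G₀) (8 * t * Real.log (2 * L) * G₀) hε₀)
  obtain ⟨N₆, hN₆⟩ := Filter.eventually_atTop.mp
    (eventually_loglog (t - 1) 0 (16 * t * (Cπ + 1) * G₀) hε₀)
  refine ⟨max (max (max N₁ N₂) (max N₃ N₄)) (max (max N₅ N₆) 3),
    fun N hN u hu2 Ψ hΨ hL K hK hKN => ?_⟩
  have h14 := le_of_max_le_left hN
  have h56 := le_of_max_le_right hN
  have hNN₁ : N₁ ≤ N := le_of_max_le_left (le_of_max_le_left h14)
  have hNN₂ : N₂ ≤ N := le_of_max_le_right (le_of_max_le_left h14)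
  have hNN₃ : N₃ ≤ N := le_of_max_le_left (le_of_max_le_right h14)
  have hNN₄ : N₄ ≤ N := le_of_max_le_right (le_of_max_le_right h14)
  have hNN₅ : N₅ ≤ N := le_of_max_le_left (le_of_max_le_left h56)
  have hNN₆ : N₆ ≤ N := le_of_max_le_right (le_of_max_le_left h56)
  have hN3 : 3 ≤ N := le_of_max_le_right h56
  have hx0 : (0 : ℝ) < N := by
    have : (3 : ℝ) ≤ N := by exact_mod_cast hN3
    linarith
  -- `DimOne` at this scale
  have hVM := hN₃ N hNN₃ Ψ hΨ hL K hK hKN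
  -- the singular mass `0 ≤ M ≤ G N`, `G = (2 C_S + 1) (log log N)^{t-1}`
  have hS0 : 0 ≤ singularProduct Ψ := singularProduct_nonneg hΨ
  have hAF0 : 0 ≤ archFactor Ψ K := ENNReal.toReal_nonneg
  have hAF2 : archFactor Ψ K ≤ 2 * (N : ℝ) := archFactor_le_two_mul Ψ hKN
  have hSP := hN₁ N hNN₁ Ψ hΨ hL
  obtain ⟨hll1, hdist0⟩ := hN₅ N hNN₅
  obtain ⟨-, hkap0⟩ := hN₆ N hNN₆
  set Λ : ℝ := Real.log (Real.log N) with hΛdef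
  have hΛp : 1 ≤ Λ ^ (t - 1) := one_le_pow₀ hll1
  have hG₀1 : 1 ≤ G₀ := by rw [hG₀def]; linarith only [hCS]
  have hG₀2 : 2 * CS ≤ G₀ := by rw [hG₀def]; linarith only
  set G : ℝ := G₀ * Λ ^ (t - 1) with hGdef
  have hG1 : 1 ≤ G := by
    rw [hGdef]
    exact one_le_mul_of_one_le_of_one_le hG₀1 hΛp
  have hMG : archFactor Ψ K * singularProduct Ψ ≤ G * N := by
    calc archFactor Ψ K * singularProduct Ψ ≤ (2 * (N : ℝ)) * (CS * Λ ^ (t - 1)) :=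
          mul_le_mul hAF2 hSP hS0 (by positivity)
      _ = (2 * CS) * Λ ^ (t - 1) * N := by ring
      _ ≤ G₀ * Λ ^ (t - 1) * N :=
          mul_le_mul_of_nonneg_right (mul_le_mul_of_nonneg_right hG₀2 (by positivity)) hx0.le
  have hdist : 8 * t * ((t + 1) * Λ + Real.log (2 * L)) * G ≤ ε₀ * Real.log N := by
    calc 8 * t * ((t + 1) * Λ + Real.log (2 * L)) * G
        = (8 * t * (t + 1) * G₀ * Λ + 8 * t * Real.log (2 * L) * G₀) * Λ ^ (t - 1) := by
          rw [hGdef]; ring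
      _ ≤ ε₀ * Real.log N := hdist0
  have hkap : 16 * t * (Cπ + 1) * G ≤ ε₀ * Real.log N := by
    calc 16 * t * (Cπ + 1) * G = (0 * Λ + 16 * t * (Cπ + 1) * G₀) * Λ ^ (t - 1) := by
          rw [hGdef]; ring
      _ ≤ ε₀ * Real.log N := hkap0
  obtain ⟨hCℓ, -, hℓpow, hℓsqrt⟩ := hN₄ N hNN₄
  have hℓt : 144 * t ≤ ε₀ * Real.log N := by
    rw [div_le_iff₀ hε₀] at hCℓ
    linarith only [hCℓ]
  have hZ0 : 0 ≤ (N : ℝ) ^ ((1 : ℝ) / u) := by positivity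
  have key := abs_cells_sub_le_of_vonMangoldtSum (Cn := (jointCell Ψ K N u (fun _ => 1) : ℝ))
    (A₁ := (roughCell N u 1 : ℝ)) Ψ K ht hN3 hu2 hε₀ hε₀1 hΨ hL hc₂0 hc₂ hℓt
    hℓpow hℓsqrt hG1 (mul_nonneg hAF0 hS0) hMG hdist hCπ (hN₂ N hNN₂) hkap hVM
    (card_cells_le_primePointCount N _ Ψ K)
    (primePointCount_le_card_cells_add hZ0 Ψ hΨ K) (primeCounting_le_card_roughPrimes_add N hZ0)
    (card_roughPrimes_le_primeCounting N _)
  have hmodel : modelCell Ψ K N u (fun _ => 1) =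
      archFactor Ψ K * singularProduct Ψ * ((roughCell N u 1 : ℝ) / N) ^ t := by
    simp only [modelCell, Finset.prod_const, Finset.card_univ, Fintype.card_fin]
  rw [hmodel]
  calc _ ≤ ε₀ * N / Real.log N ^ t := key
    _ ≤ ε * N / Real.log N ^ t := by
        refine div_le_div_of_nonneg_right (mul_le_mul_of_nonneg_right hε₀ε (Nat.cast_nonneg _)) ?_
        exact pow_nonneg (Real.log_natCast_nonneg N) t

/-- **`DimOne → PrimeCellsAbsolute`** (converse of the landed registered stub
`stub_cellsToDimOne : PrimeCellsAbsolute → DimOne`): take `u = 2` in `cells_abs_of_dimOne`.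
[cite: GreenTao2010, (1.8)] -/
theorem primeCellsAbsolute_of_dimOne : DimOne → PrimeCellsAbsolute := by
  intro hD t L ht ε hε
  obtain ⟨N₀, hN₀⟩ := cells_abs_of_dimOne hD t L ht ε hε
  exact ⟨N₀, fun N hN => ⟨2, le_rfl, fun Ψ hΨ hL K hK hKN => hN₀ N hN 2 le_rfl Ψ hΨ hL K hK hKN⟩⟩

/-- **The shared cell-level node of both mechanism lines is the target.**
`PrimeCellsAbsolute ↔ DimOne` (`←`: `primeCellsAbsolute_of_dimOne`; `→`: the landed registered stub
`stub_cellsToDimOne`, p100021). [cite: GreenTao2010, Conj. 1.2 and (1.8)] -/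
theorem primeCellsAbsolute_iff_dimOne : PrimeCellsAbsolute ↔ DimOne :=
  ⟨stub_cellsToDimOne, primeCellsAbsolute_of_dimOne⟩

/-- **Normal form of the crux through the shared node.** `AbsoluteUpgrade := RelativeDimOne → DimOne`
is equivalent to `RelativeDimOne → PrimeCellsAbsolute`: what either mechanism line must deliver from
the crux's hypothesis is exactly the absolute prime corner cell, i.e. (by `primeCellsAbsolute_iff_dimOne`)
the target itself. [folklore] -/
theorem absoluteUpgrade_iff_cells : AbsoluteUpgrade ↔ (RelativeDimOne → PrimeCellsAbsolute) := by
  unfold AbsoluteUpgrade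
  rw [primeCellsAbsolute_iff_dimOne]

/-- **… and without the hypothesis.** Since `DimOne → RelativeDimOne` (`relativeDimOne_of_dimOne`),
the conjunction `AbsoluteUpgrade ∧ RelativeDimOne` — what the route's `closes` consumes — is
`PrimeCellsAbsolute`. [folklore] -/
theorem absoluteUpgrade_and_relativeDimOne_iff_cells :
    (AbsoluteUpgrade ∧ RelativeDimOne) ↔ PrimeCellsAbsolute := by
  rw [primeCellsAbsolute_iff_dimOne]
  unfold AbsoluteUpgrade
  exact ⟨fun h => h.1 h.2, fun h => ⟨fun _ => h, relativeDimOne_of_dimOne h⟩⟩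

end Summit.Parity.GeneralizedHardyLittlewood.Theorems.AbsoluteUpgrade

end
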